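import Mathlib
import Literature.NumberTheory.Sieve.MaynardSimplexIntegrals
import HarnessLib

/-!
# ζ(5) search — Euler-integral kernel symmetry: the `₂F₁` parameter symmetry by real substitutions
(cell `pub-zeta5`, seat ct-1 g12)

HONEST FRAMING: systematic search; no irrationality claim unless kernel-certified. Nothing in this file is an
irrationality result, a worthiness exponent or a denominator statement; these are two identities between
absolutely convergent real integrals with natural-number exponents, the analytic input for the 'trivial'
hypergeometric symmetries `p₀₁`, `p₁₂` of Brown–Zudilin's integrals `J(p;q)` [BrownZudilin2022, Sect. 7, first half]
OUTSIDE the regime of the Barnes representation (16) (no chamber, no Mellin–Barnes integral, no residues).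

* `euler_binomial` — the Euler integral of `₂F₁(m+n+2, m+1; m+n+2; ·)`, i.e. of a binomial:
  `α^{n+1} (α+γ)^{m+1} (m+n+1)! ∫₀¹ u^m (1−u)^n (α+γu)^{−(m+n+2)} du = m! n!` for `α > 0`, `γ ≥ 0`,
  by the substitution `x = (α+γ)u/(α+γu)` which turns the integrand into the Beta integrand `x^m(1−x)^n`
  (`Literature…MaynardTao.integral_pow_mul_one_sub_pow`: `∫₀¹ x^m(1−x)^n dx = m!n!/(m+n+1)!`).
* `euler_symmetry` — the symmetry of the Euler integral of `₂F₁(a,b;c;·)` in its two upper parameters, for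
  natural parameters, as an identity of real integrals:
  `m! (p+q−m)! α^m ∫₀¹ t^p (1−t)^q (α+βt)^{−(m+1)} dt = p! q! α^p ∫₀¹ t^m (1−t)^{p+q−m} (α+βt)^{−(p+1)} dt`
  (`m ≤ p+q`, `α > 0`, `β ≥ 0`): insert `euler_binomial` for the kernel on both sides — both become the same
  double integral `∫∫ t^p(1−t)^q u^m(1−u)^{p+q−m} (α+βtu)^{−(p+q+2)}` up to the exchange `t ↔ u` (Fubini on
  `[0,1]²`). This is the classical symmetry `₂F₁(a,b;c;x) = ₂F₁(b,a;c;x)` read on Euler's integral; no series,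
  no analytic continuation.

Theorems only (no new definitions).
-/

noncomputable section

namespace Summit.KontsevichZagierPeriods.Zeta5Search.EulerKernelSymmetry

open MeasureTheory Set intervalIntegral
open scoped Nat
open Literature.NumberTheory.Sieve (MaynardTao.integral_pow_mul_one_sub_pow)

/-- The pointwise identity behind the substitution `x = (α+γ)u/(α+γu)`:
`x^m (1−x)^n · dx/du = α^{n+1}(α+γ)^{m+1} u^m(1−u)^n/(α+γu)^{m+n+2}`. -/
theorem subst_pointwise (m n : ℕ) {α γ u : ℝ} (hd : 0 < α + γ * u) :
    ((α + γ) * u / (α + γ * u)) ^ m * (1 - (α + γ) * u / (α + γ * u)) ^ n * (α * (α + γ) / (α + γ * u) ^ 2) =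
      α ^ (n + 1) * (α + γ) ^ (m + 1) * (u ^ m * (1 - u) ^ n / (α + γ * u) ^ (m + n + 2)) := by
  have hd' : α + γ * u ≠ 0 := hd.ne'
  have h1 : 1 - (α + γ) * u / (α + γ * u) = α * (1 - u) / (α + γ * u) := by
    field_simp
    ring
  rw [h1, div_pow, div_pow, mul_pow, mul_pow]
  field_simp
  ring

/-- **Euler's integral for a binomial** (`₂F₁(c, a; c; −γ/α)`-type, natural exponents): for `α > 0`, `γ ≥ 0`,
`α^{n+1} (α+γ)^{m+1} (m+n+1)! ∫₀¹ u^m(1−u)^n (α+γu)^{−(m+n+2)} du = m! n!`.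
Proof: the substitution `x = (α+γ)u/(α+γu)` maps `[0,1]` onto `[0,1]` and turns the integrand into
`x^m(1−x)^n`, whose integral is `m!n!/(m+n+1)!`. -/
theorem euler_binomial (m n : ℕ) {α γ : ℝ} (hα : 0 < α) (hγ : 0 ≤ γ) :
    α ^ (n + 1) * (α + γ) ^ (m + 1) * ((m + n + 1)! : ℝ) *
        ∫ u in (0:ℝ)..1, u ^ m * (1 - u) ^ n / (α + γ * u) ^ (m + n + 2) = (m ! : ℝ) * n ! := by
  have hden : ∀ u ∈ uIcc (0:ℝ) 1, 0 < α + γ * u := by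
    intro u hu
    rw [uIcc_of_le zero_le_one] at hu
    have := mul_nonneg hγ hu.1
    linarith
  have hderiv : ∀ u ∈ uIcc (0:ℝ) 1,
      HasDerivAt (fun u : ℝ => (α + γ) * u / (α + γ * u)) (α * (α + γ) / (α + γ * u) ^ 2) u := by
    intro u hu
    have hd := (hden u hu).ne'
    have h1 : HasDerivAt (fun u : ℝ => (α + γ) * u) (α + γ) u := by
      simpa using (hasDerivAt_id u).const_mul (α + γ)
    have h2 : HasDerivAt (fun u : ℝ => α + γ * u) γ u := by
      simpa using ((hasDerivAt_id u).const_mul γ).const_add α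
    have h := h1.div h2 hd
    refine h.congr_deriv ?_
    field_simp
    ring
  have hcont : ContinuousOn (fun u : ℝ => α * (α + γ) / (α + γ * u) ^ 2) (uIcc (0:ℝ) 1) := by
    intro u hu
    have hd := (hden u hu).ne'
    apply ContinuousAt.continuousWithinAt
    apply ContinuousAt.div continuousAt_const
    · exact ((continuous_const.add (continuous_const.mul continuous_id)).pow 2).continuousAt
    · exact pow_ne_zero 2 hd
  have hg : Continuous fun x : ℝ => x ^ m * (1 - x) ^ n := by fun_prop
  have key := intervalIntegral.integral_comp_mul_deriv hderiv hcont hg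
  have h0 : (α + γ) * 0 / (α + γ * 0) = (0:ℝ) := by simp
  have h1 : (α + γ) * 1 / (α + γ * 1) = (1:ℝ) := by
    have h11 := (hden 1 (by simp)).ne'
    simp only [mul_one] at h11 ⊢
    exact div_self h11
  rw [h0, h1, MaynardTao.integral_pow_mul_one_sub_pow] at key
  have hfac : ((m + n + 1)! : ℝ) ≠ 0 := by positivity
  have hI : ∫ u in (0:ℝ)..1, u ^ m * (1 - u) ^ n / (α + γ * u) ^ (m + n + 2) =
      (α ^ (n + 1) * (α + γ) ^ (m + 1))⁻¹ * ((m ! * n ! : ℝ) / (m + n + 1)!) := by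
    rw [← key, ← intervalIntegral.integral_const_mul]
    refine intervalIntegral.integral_congr fun u hu => ?_
    have hpos : 0 < α ^ (n + 1) * (α + γ) ^ (m + 1) := by
      have := hden 1 (by simp)
      simp only [mul_one] at this
      positivity
    simp only [Function.comp_apply]
    rw [subst_pointwise m n (hden u hu), ← mul_assoc, inv_mul_cancel₀ hpos.ne', one_mul]
  rw [hI]
  have hpos : α ^ (n + 1) * (α + γ) ^ (m + 1) ≠ 0 := by
    have := hden 1 (by simp)
    simp only [mul_one] at this
    positivity
  field_simp

/-- The double integrand shared by both sides of `euler_symmetry`. -/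
theorem continuousOn_double (m k p q : ℕ) {α β : ℝ} (hα : 0 < α) (hβ : 0 ≤ β) :
    ContinuousOn (fun z : ℝ × ℝ => z.2 ^ p * (1 - z.2) ^ q *
        (z.1 ^ m * (1 - z.1) ^ k / (α + β * z.2 * z.1) ^ (p + q + 2))) (Icc 0 1 ×ˢ Icc 0 1) := by
  have hne : ∀ z ∈ Icc (0:ℝ) 1 ×ˢ Icc (0:ℝ) 1, (α + β * z.2 * z.1) ^ (p + q + 2) ≠ 0 := by
    rintro ⟨t, u⟩ ⟨ht, hu⟩
    apply pow_ne_zero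
    have : 0 ≤ β * u * t := mul_nonneg (mul_nonneg hβ hu.1) ht.1
    simp only
    linarith
  refine ContinuousOn.mul (Continuous.continuousOn (by fun_prop)) ?_
  exact ContinuousOn.div (Continuous.continuousOn (by fun_prop)) (Continuous.continuousOn (by fun_prop)) hne

/-- Fubini on `[0,1]²` for the shared double integrand: the two iterated integrals agree. -/
theorem double_swap (m k p q : ℕ) {α β : ℝ} (hα : 0 < α) (hβ : 0 ≤ β) :
    ∫ t in (0:ℝ)..1, ∫ u in (0:ℝ)..1,
        u ^ p * (1 - u) ^ q * (t ^ m * (1 - t) ^ k / (α + β * u * t) ^ (p + q + 2)) =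
      ∫ u in (0:ℝ)..1, ∫ t in (0:ℝ)..1,
        u ^ p * (1 - u) ^ q * (t ^ m * (1 - t) ^ k / (α + β * u * t) ^ (p + q + 2)) := by
  simp_rw [intervalIntegral.integral_of_le (zero_le_one' ℝ)]
  have hInt : Integrable (Function.uncurry fun (t u : ℝ) =>
      u ^ p * (1 - u) ^ q * (t ^ m * (1 - t) ^ k / (α + β * u * t) ^ (p + q + 2)))
      ((volume.restrict (Ioc (0:ℝ) 1)).prod (volume.restrict (Ioc (0:ℝ) 1))) := by
    rw [Measure.prod_restrict, ← Measure.volume_eq_prod]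
    have hI : IntegrableOn (fun z : ℝ × ℝ => z.2 ^ p * (1 - z.2) ^ q *
        (z.1 ^ m * (1 - z.1) ^ k / (α + β * z.2 * z.1) ^ (p + q + 2))) (Icc 0 1 ×ˢ Icc 0 1) :=
      (continuousOn_double m k p q hα hβ).integrableOn_compact (isCompact_Icc.prod isCompact_Icc)
    exact hI.mono_set (Set.prod_mono Ioc_subset_Icc_self Ioc_subset_Icc_self)
  exact integral_integral_swap hInt

/-- One side of `euler_symmetry` as a double integral: for `t ∈ [0,1]`,
`m!(p+q−m)! · t^p(1−t)^q/(α+βt)^{m+1} = (p+q+1)! α^{p+q−m+1} ∫₀¹ t^p(1−t)^q u^m(1−u)^{p+q−m}/(α+βtu)^{p+q+2} du`. -/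
theorem kernel_as_integral (m p q : ℕ) (hm : m ≤ p + q) {α β t : ℝ} (hα : 0 < α) (hβ : 0 ≤ β)
    (ht : t ∈ uIcc (0:ℝ) 1) :
    (m ! * (p + q - m)! : ℝ) * (t ^ p * (1 - t) ^ q / (α + β * t) ^ (m + 1)) =
      ((p + q + 1)! : ℝ) * α ^ (p + q - m + 1) *
        ∫ u in (0:ℝ)..1, t ^ p * (1 - t) ^ q * (u ^ m * (1 - u) ^ (p + q - m) / (α + β * t * u) ^ (p + q + 2)) := by
  rw [uIcc_of_le zero_le_one] at ht
  have hγ : 0 ≤ β * t := mul_nonneg hβ ht.1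
  have L := euler_binomial m (p + q - m) hα hγ
  have e1 : m + (p + q - m) + 1 = p + q + 1 := by omega
  have e2 : m + (p + q - m) + 2 = p + q + 2 := by omega
  rw [e1, e2] at L
  have hd : α + β * t ≠ 0 := by have := mul_nonneg hβ ht.1; linarith
  rw [intervalIntegral.integral_const_mul, ← L]
  field_simp

/-- **The `₂F₁` parameter symmetry on Euler's integral** (natural parameters, `α > 0`, `β ≥ 0`, `m ≤ p+q`):
`m! (p+q−m)! α^m ∫₀¹ t^p(1−t)^q (α+βt)^{−(m+1)} dt = p! q! α^p ∫₀¹ t^m(1−t)^{p+q−m} (α+βt)^{−(p+1)} dt`.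
With `a = m+1`, `b = p+1`, `c = p+q+2`, `x = −β/α` this is `B(b,c−b)⁻¹∫t^{b−1}(1−t)^{c−b−1}(1−xt)^{−a} =
B(a,c−a)⁻¹∫t^{a−1}(1−t)^{c−a−1}(1−xt)^{−b}`, i.e. `₂F₁(a,b;c;x) = ₂F₁(b,a;c;x)`. -/
theorem euler_symmetry (m p q : ℕ) (hm : m ≤ p + q) {α β : ℝ} (hα : 0 < α) (hβ : 0 ≤ β) :
    (m ! * (p + q - m)! : ℝ) * α ^ m * ∫ t in (0:ℝ)..1, t ^ p * (1 - t) ^ q / (α + β * t) ^ (m + 1) =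
      (p ! * q ! : ℝ) * α ^ p * ∫ t in (0:ℝ)..1, t ^ m * (1 - t) ^ (p + q - m) / (α + β * t) ^ (p + 1) := by
  -- left side as a double integral
  have hB : (m ! * (p + q - m)! : ℝ) * ∫ t in (0:ℝ)..1, t ^ p * (1 - t) ^ q / (α + β * t) ^ (m + 1) =
      ((p + q + 1)! : ℝ) * α ^ (p + q - m + 1) * ∫ t in (0:ℝ)..1, ∫ u in (0:ℝ)..1,
        t ^ p * (1 - t) ^ q * (u ^ m * (1 - u) ^ (p + q - m) / (α + β * t * u) ^ (p + q + 2)) := by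
    rw [← intervalIntegral.integral_const_mul, ← intervalIntegral.integral_const_mul]
    exact intervalIntegral.integral_congr fun t ht => kernel_as_integral m p q hm hα hβ ht
  -- right side as a double integral: `euler_symmetry` parameters `(p; m, p+q-m)`, same total `p+q`
  have hm' : p ≤ m + (p + q - m) := by omega
  have hC := fun (t : ℝ) (ht : t ∈ uIcc (0:ℝ) 1) => kernel_as_integral p m (p + q - m) hm' hα hβ ht
  have e3 : m + (p + q - m) - p = q := by omega
  have e4 : m + (p + q - m) + 1 = p + q + 1 := by omega
  have e5 : m + (p + q - m) + 2 = p + q + 2 := by omega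
  simp only [e3, e4, e5] at hC
  have hC' : (p ! * q ! : ℝ) * ∫ t in (0:ℝ)..1, t ^ m * (1 - t) ^ (p + q - m) / (α + β * t) ^ (p + 1) =
      ((p + q + 1)! : ℝ) * α ^ (q + 1) * ∫ t in (0:ℝ)..1, ∫ u in (0:ℝ)..1,
        t ^ m * (1 - t) ^ (p + q - m) * (u ^ p * (1 - u) ^ q / (α + β * t * u) ^ (p + q + 2)) := by
    rw [← intervalIntegral.integral_const_mul, ← intervalIntegral.integral_const_mul]
    exact intervalIntegral.integral_congr fun t ht => hC t ht
  -- the two double integrals coincide after `t ↔ u`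
  have hD : ∫ t in (0:ℝ)..1, ∫ u in (0:ℝ)..1,
        t ^ m * (1 - t) ^ (p + q - m) * (u ^ p * (1 - u) ^ q / (α + β * t * u) ^ (p + q + 2)) =
      ∫ t in (0:ℝ)..1, ∫ u in (0:ℝ)..1,
        t ^ p * (1 - t) ^ q * (u ^ m * (1 - u) ^ (p + q - m) / (α + β * t * u) ^ (p + q + 2)) := by
    have h1 : ∫ t in (0:ℝ)..1, ∫ u in (0:ℝ)..1,
        t ^ m * (1 - t) ^ (p + q - m) * (u ^ p * (1 - u) ^ q / (α + β * t * u) ^ (p + q + 2)) =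
        ∫ t in (0:ℝ)..1, ∫ u in (0:ℝ)..1,
          u ^ p * (1 - u) ^ q * (t ^ m * (1 - t) ^ (p + q - m) / (α + β * u * t) ^ (p + q + 2)) := by
      refine intervalIntegral.integral_congr fun t _ => intervalIntegral.integral_congr fun u _ => ?_
      rw [mul_right_comm β u t]
      ring
    rw [h1, double_swap m (p + q - m) p q hα hβ]
  rw [hD] at hC'
  have e7 : α ^ m * α ^ (p + q - m + 1) = α ^ (p + q + 1) := by
    rw [← pow_add, show m + (p + q - m + 1) = p + q + 1 from by omega]
  have e8 : α ^ p * α ^ (q + 1) = α ^ (p + q + 1) := by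
    rw [← pow_add, ← add_assoc]
  calc (m ! * (p + q - m)! : ℝ) * α ^ m * ∫ t in (0:ℝ)..1, t ^ p * (1 - t) ^ q / (α + β * t) ^ (m + 1)
      = α ^ m * ((m ! * (p + q - m)! : ℝ) * ∫ t in (0:ℝ)..1, t ^ p * (1 - t) ^ q / (α + β * t) ^ (m + 1)) := by
        ring
    _ = ((p + q + 1)! : ℝ) * α ^ (p + q + 1) * ∫ t in (0:ℝ)..1, ∫ u in (0:ℝ)..1,
        t ^ p * (1 - t) ^ q * (u ^ m * (1 - u) ^ (p + q - m) / (α + β * t * u) ^ (p + q + 2)) := by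
        rw [hB, ← e7]; ring
    _ = α ^ p * ((p ! * q ! : ℝ) * ∫ t in (0:ℝ)..1, t ^ m * (1 - t) ^ (p + q - m) / (α + β * t) ^ (p + 1)) := by
        rw [hC', ← e8]; ring
    _ = (p ! * q ! : ℝ) * α ^ p * ∫ t in (0:ℝ)..1, t ^ m * (1 - t) ^ (p + q - m) / (α + β * t) ^ (p + 1) := by
        ring

end Summit.KontsevichZagierPeriods.Zeta5Search.EulerKernelSymmetry

end
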